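import Mathlib
import Literature.Probability.LatticeModels.TorusFourierWeightedConvolution
import HarnessLib

/-!
# Character sums on a product of two discrete tori: product of symbols ↦ convolution of character sums, and Young's `ℓ¹` inequality

Topic `Probability/LatticeModels`; sequel of `TorusFourierProofs` (characters `χ_k(x)` of `(ℤ/Lℤ)^d`, orthogonality) and of
`TorusFourierWeightedConvolution` (`torusFourierInv_mul`: on ONE torus the inverse transform of a product is the convolution of the inverse
transforms).  Here the group is a PRODUCT `(ℤ/L₁ℤ)^{d₁} × (ℤ/L₂ℤ)^{d₂}` with the product characters `χ_q(z) = χ_{q₁}(z₁)·χ_{q₂}(z₂)` — the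
space-time torus `(ℤ/2Mℤ) × (ℤ/Lℤ)²` of the imaginary-time × lattice character sums of BGM's sector multipliers (Benfatto–Giuliani–Mastropietro
2006, §2.7 (2.71a): the `L¹` size of the overlap kernel of two sector families is the `ℓ¹` norm of the character sum of the PRODUCT of their
symbols).  For symbols `G₁, G₂` on the product torus and `S_G(z) := Σ_q χ_q(z) G(q)`:

* `prodChar_sub_right`, `sum_prodChar_mul_conj` — `χ_q(z − w) = χ_q(z)·conj χ_q(w)` and the orthogonality
  `Σ_w χ_{q′}(w)·conj χ_q(w) = |G|·δ_{q′,q}`, `|G| = L₁^{d₁}·L₂^{d₂}`;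
* **`prodCharSum_mul_eq_conv`** — `|G| · S_{G₁G₂}(z) = Σ_w S_{G₂}(w) · S_{G₁}(z − w)` (exact);
* **`sum_norm_prodCharSum_mul_le`** — YOUNG: `Σ_z ‖S_{G₁G₂}(z)‖ ≤ |G|⁻¹ · (Σ_z ‖S_{G₁}(z)‖) · (Σ_z ‖S_{G₂}(z)‖)`.

So the `ℓ¹` character-sum size of a product of two multipliers is controlled by the sizes of the factors — uniformly in any scale
separation between them (cell gate-hubbard-kl, K3 engine child clause (E1): the overlap constants of a re-sectorisation at a JUMP of scales,
from the neighbouring-scale bounds).  Everything is proved; no definitions; no named facts.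

## Sources

G. Benfatto, A. Giuliani, V. Mastropietro, Ann. Henri Poincaré 7 (2006) 809–898, §2.7 (2.71a) [`BenfattoGiulianiMastropietro2006`];
S. Friedli, Y. Velenik, *Statistical Mechanics of Lattice Systems* (2017), §10.4 (characters of the discrete torus) [`FriedliVelenik2017`].
-/

noncomputable section

namespace Literature.Probability.LatticeModels

open Finset
open scoped ComplexConjugate

variable {d₁ d₂ L₁ L₂ : ℕ} [NeZero L₁] [NeZero L₂]

/-- `χ_q(z − w) = χ_q(z) · conj χ_q(w)` for the product characters. [cite: FriedliVelenik2017, §10.4] -/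
theorem prodChar_sub_right (q z w : TorusSite d₁ L₁ × TorusSite d₂ L₂) :
    torusChar q.1 (z - w).1 * torusChar q.2 (z - w).2 =
      (torusChar q.1 z.1 * torusChar q.2 z.2) * conj (torusChar q.1 w.1 * torusChar q.2 w.2) := by
  rw [Prod.fst_sub, Prod.snd_sub, torusChar_sub_right, torusChar_sub_right, map_mul]
  ring

/-- **Orthogonality on the product torus**: `Σ_w χ_{q′}(w)·conj χ_q(w) = L₁^{d₁} L₂^{d₂}` if `q′ = q` and `0` otherwise.
[cite: FriedliVelenik2017, §10.4] -/
theorem sum_prodChar_mul_conj (q' q : TorusSite d₁ L₁ × TorusSite d₂ L₂) :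
    ∑ w : TorusSite d₁ L₁ × TorusSite d₂ L₂,
        (torusChar q'.1 w.1 * torusChar q'.2 w.2) * conj (torusChar q.1 w.1 * torusChar q.2 w.2) =
      if q' = q then ((L₁ : ℂ) ^ d₁ * (L₂ : ℂ) ^ d₂) else 0 := by
  have hterm : ∀ w : TorusSite d₁ L₁ × TorusSite d₂ L₂,
      (torusChar q'.1 w.1 * torusChar q'.2 w.2) * conj (torusChar q.1 w.1 * torusChar q.2 w.2) =
        torusChar (q'.1 - q.1) w.1 * torusChar (q'.2 - q.2) w.2 := by
    intro w
    rw [map_mul, ← torusChar_mul_conj_torusChar, ← torusChar_mul_conj_torusChar]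
    ring
  simp_rw [hterm]
  rw [Fintype.sum_prod_type, ← Fintype.sum_mul_sum, sum_torusChar_right, sum_torusChar_right]
  by_cases h : q' = q
  · subst h
    simp
  · rw [if_neg h]
    have h' : q'.1 - q.1 ≠ 0 ∨ q'.2 - q.2 ≠ 0 := by
      by_contra hc
      push Not at hc
      exact h (Prod.ext (sub_eq_zero.1 hc.1) (sub_eq_zero.1 hc.2))
    rcases h' with h1 | h2
    · rw [if_neg h1, zero_mul]
    · rw [if_neg h2, mul_zero]

/-- **Product of symbols ↦ convolution of character sums** (exact, finite product torus):
`L₁^{d₁} L₂^{d₂} · Σ_q χ_q(z) G₁(q)G₂(q) = Σ_w (Σ_q χ_q(w) G₂(q)) · (Σ_q χ_q(z − w) G₁(q))`. [cite: FriedliVelenik2017, §10.4] -/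
theorem prodCharSum_mul_eq_conv (G₁ G₂ : TorusSite d₁ L₁ × TorusSite d₂ L₂ → ℂ) (z : TorusSite d₁ L₁ × TorusSite d₂ L₂) :
    ((L₁ : ℂ) ^ d₁ * (L₂ : ℂ) ^ d₂) *
        ∑ q : TorusSite d₁ L₁ × TorusSite d₂ L₂, (torusChar q.1 z.1 * torusChar q.2 z.2) • (G₁ q * G₂ q) =
      ∑ w : TorusSite d₁ L₁ × TorusSite d₂ L₂,
        (∑ q : TorusSite d₁ L₁ × TorusSite d₂ L₂, (torusChar q.1 w.1 * torusChar q.2 w.2) • G₂ q) *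
          (∑ q : TorusSite d₁ L₁ × TorusSite d₂ L₂, (torusChar q.1 (z - w).1 * torusChar q.2 (z - w).2) • G₁ q) := by
  set c : ℂ := (L₁ : ℂ) ^ d₁ * (L₂ : ℂ) ^ d₂ with hc
  simp only [smul_eq_mul]
  -- expand the right-hand side into a triple sum and move the `w`-sum inside
  have hR : ∀ w : TorusSite d₁ L₁ × TorusSite d₂ L₂,
      (∑ q', torusChar q'.1 w.1 * torusChar q'.2 w.2 * G₂ q') * (∑ q, torusChar q.1 (z - w).1 * torusChar q.2 (z - w).2 * G₁ q) =
        ∑ q, ∑ q', G₁ q * G₂ q' * (torusChar q.1 z.1 * torusChar q.2 z.2) *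
          ((torusChar q'.1 w.1 * torusChar q'.2 w.2) * conj (torusChar q.1 w.1 * torusChar q.2 w.2)) := by
    intro w
    rw [Finset.sum_mul_sum, Finset.sum_comm]
    refine sum_congr rfl fun q _ => sum_congr rfl fun q' _ => ?_
    rw [prodChar_sub_right]
    ring
  simp_rw [hR]
  rw [Finset.sum_comm]
  -- the `w`-sum is the orthogonality relation
  have hin : ∀ q : TorusSite d₁ L₁ × TorusSite d₂ L₂,
      ∑ w : TorusSite d₁ L₁ × TorusSite d₂ L₂, ∑ q' : TorusSite d₁ L₁ × TorusSite d₂ L₂,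
        G₁ q * G₂ q' * (torusChar q.1 z.1 * torusChar q.2 z.2) *
          ((torusChar q'.1 w.1 * torusChar q'.2 w.2) * conj (torusChar q.1 w.1 * torusChar q.2 w.2)) =
        c * (torusChar q.1 z.1 * torusChar q.2 z.2 * (G₁ q * G₂ q)) := by
    intro q
    rw [Finset.sum_comm]
    have h2 : ∀ q' : TorusSite d₁ L₁ × TorusSite d₂ L₂,
        ∑ w : TorusSite d₁ L₁ × TorusSite d₂ L₂, G₁ q * G₂ q' * (torusChar q.1 z.1 * torusChar q.2 z.2) *
          ((torusChar q'.1 w.1 * torusChar q'.2 w.2) * conj (torusChar q.1 w.1 * torusChar q.2 w.2)) =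
        G₁ q * G₂ q' * (torusChar q.1 z.1 * torusChar q.2 z.2) * (if q' = q then c else 0) := by
      intro q'
      rw [← mul_sum, sum_prodChar_mul_conj]
    simp_rw [h2, mul_ite, mul_zero]
    rw [Finset.sum_ite_eq' univ q]
    simp only [mem_univ, if_true]
    ring
  simp_rw [hin]
  rw [← mul_sum]

/-- **Young's inequality for character sums on the product torus**: with `S_G(z) = Σ_q χ_q(z) G(q)`,
`Σ_z ‖S_{G₁G₂}(z)‖ ≤ (L₁^{d₁} L₂^{d₂})⁻¹ · (Σ_z ‖S_{G₁}(z)‖) · (Σ_z ‖S_{G₂}(z)‖)` — the `ℓ¹` size of the character sum of a product of two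
multipliers from the sizes of the factors, whatever their scales. [cite: BenfattoGiulianiMastropietro2006, §2.7 (2.71a)] -/
theorem sum_norm_prodCharSum_mul_le (G₁ G₂ : TorusSite d₁ L₁ × TorusSite d₂ L₂ → ℂ) :
    ∑ z : TorusSite d₁ L₁ × TorusSite d₂ L₂,
        ‖∑ q : TorusSite d₁ L₁ × TorusSite d₂ L₂, (torusChar q.1 z.1 * torusChar q.2 z.2) • (G₁ q * G₂ q)‖ ≤
      (((L₁ : ℝ) ^ d₁ * (L₂ : ℝ) ^ d₂)⁻¹ *
        ((∑ z : TorusSite d₁ L₁ × TorusSite d₂ L₂,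
            ‖∑ q : TorusSite d₁ L₁ × TorusSite d₂ L₂, (torusChar q.1 z.1 * torusChar q.2 z.2) • G₁ q‖) *
          ∑ z : TorusSite d₁ L₁ × TorusSite d₂ L₂,
            ‖∑ q : TorusSite d₁ L₁ × TorusSite d₂ L₂, (torusChar q.1 z.1 * torusChar q.2 z.2) • G₂ q‖)) := by
  have hcR : (0 : ℝ) < (L₁ : ℝ) ^ d₁ * (L₂ : ℝ) ^ d₂ := by
    have h1 : (0 : ℝ) < L₁ := Nat.cast_pos.2 (Nat.pos_of_ne_zero (NeZero.ne L₁))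
    have h2 : (0 : ℝ) < L₂ := Nat.cast_pos.2 (Nat.pos_of_ne_zero (NeZero.ne L₂))
    positivity
  have hcC : ((L₁ : ℂ) ^ d₁ * (L₂ : ℂ) ^ d₂) ≠ 0 := mul_ne_zero natCast_pow_ne_zero natCast_pow_ne_zero
  have hnc : ‖((L₁ : ℂ) ^ d₁ * (L₂ : ℂ) ^ d₂)‖ = (L₁ : ℝ) ^ d₁ * (L₂ : ℝ) ^ d₂ := by
    rw [norm_mul, norm_pow, norm_pow, Complex.norm_natCast, Complex.norm_natCast]
  -- pointwise: `‖S₁₂(z)‖ ≤ |G|⁻¹ Σ_w ‖S₂ w‖ ‖S₁ (z - w)‖`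
  have hpt : ∀ z : TorusSite d₁ L₁ × TorusSite d₂ L₂,
      ‖∑ q : TorusSite d₁ L₁ × TorusSite d₂ L₂, (torusChar q.1 z.1 * torusChar q.2 z.2) • (G₁ q * G₂ q)‖ ≤
        ((L₁ : ℝ) ^ d₁ * (L₂ : ℝ) ^ d₂)⁻¹ * ∑ w : TorusSite d₁ L₁ × TorusSite d₂ L₂,
          ‖∑ q : TorusSite d₁ L₁ × TorusSite d₂ L₂, (torusChar q.1 w.1 * torusChar q.2 w.2) • G₂ q‖ *
            ‖∑ q : TorusSite d₁ L₁ × TorusSite d₂ L₂, (torusChar q.1 (z - w).1 * torusChar q.2 (z - w).2) • G₁ q‖ := by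
    intro z
    have heq : ∑ q : TorusSite d₁ L₁ × TorusSite d₂ L₂, (torusChar q.1 z.1 * torusChar q.2 z.2) • (G₁ q * G₂ q) =
        ((L₁ : ℂ) ^ d₁ * (L₂ : ℂ) ^ d₂)⁻¹ * ∑ w : TorusSite d₁ L₁ × TorusSite d₂ L₂,
          (∑ q : TorusSite d₁ L₁ × TorusSite d₂ L₂, (torusChar q.1 w.1 * torusChar q.2 w.2) • G₂ q) *
            (∑ q : TorusSite d₁ L₁ × TorusSite d₂ L₂, (torusChar q.1 (z - w).1 * torusChar q.2 (z - w).2) • G₁ q) := by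
      rw [← prodCharSum_mul_eq_conv G₁ G₂ z, ← mul_assoc, inv_mul_cancel₀ hcC, one_mul]
    rw [heq, norm_mul, norm_inv, hnc]
    refine mul_le_mul_of_nonneg_left ((norm_sum_le _ _).trans (le_of_eq (sum_congr rfl fun w _ => norm_mul _ _))) ?_
    exact inv_nonneg.2 hcR.le
  calc ∑ z : TorusSite d₁ L₁ × TorusSite d₂ L₂,
        ‖∑ q : TorusSite d₁ L₁ × TorusSite d₂ L₂, (torusChar q.1 z.1 * torusChar q.2 z.2) • (G₁ q * G₂ q)‖
      ≤ ∑ z : TorusSite d₁ L₁ × TorusSite d₂ L₂, ((L₁ : ℝ) ^ d₁ * (L₂ : ℝ) ^ d₂)⁻¹ *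
          ∑ w : TorusSite d₁ L₁ × TorusSite d₂ L₂,
            ‖∑ q : TorusSite d₁ L₁ × TorusSite d₂ L₂, (torusChar q.1 w.1 * torusChar q.2 w.2) • G₂ q‖ *
              ‖∑ q : TorusSite d₁ L₁ × TorusSite d₂ L₂, (torusChar q.1 (z - w).1 * torusChar q.2 (z - w).2) • G₁ q‖ :=
        sum_le_sum fun z _ => hpt z
    _ = ((L₁ : ℝ) ^ d₁ * (L₂ : ℝ) ^ d₂)⁻¹ * ∑ w : TorusSite d₁ L₁ × TorusSite d₂ L₂,
          ‖∑ q : TorusSite d₁ L₁ × TorusSite d₂ L₂, (torusChar q.1 w.1 * torusChar q.2 w.2) • G₂ q‖ *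
            ∑ z : TorusSite d₁ L₁ × TorusSite d₂ L₂,
              ‖∑ q : TorusSite d₁ L₁ × TorusSite d₂ L₂, (torusChar q.1 (z - w).1 * torusChar q.2 (z - w).2) • G₁ q‖ := by
        rw [← mul_sum, Finset.sum_comm]
        exact congrArg _ (sum_congr rfl fun w _ => by rw [mul_sum])
    _ = ((L₁ : ℝ) ^ d₁ * (L₂ : ℝ) ^ d₂)⁻¹ * ∑ w : TorusSite d₁ L₁ × TorusSite d₂ L₂,
          ‖∑ q : TorusSite d₁ L₁ × TorusSite d₂ L₂, (torusChar q.1 w.1 * torusChar q.2 w.2) • G₂ q‖ *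
            ∑ z : TorusSite d₁ L₁ × TorusSite d₂ L₂,
              ‖∑ q : TorusSite d₁ L₁ × TorusSite d₂ L₂, (torusChar q.1 z.1 * torusChar q.2 z.2) • G₁ q‖ := by
        refine congrArg _ (sum_congr rfl fun w _ => congrArg _ ?_)
        exact Fintype.sum_equiv (Equiv.subRight w) _ _ fun z => rfl
    _ = _ := by rw [← sum_mul, mul_comm (∑ w : TorusSite d₁ L₁ × TorusSite d₂ L₂, _)]

end Literature.Probability.LatticeModels

end
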